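import Literature.AlgebraicGeometry.AbelianSchemes.AbelianSchemeLDeltaHalfPicZero
import Literature.AlgebraicGeometry.AbelianSchemes.AbelianSchemeBaseChangeComp
import HarnessLib

/-!
# The family `L_T ⊗ L^Δ_T(ν)⁻¹` on `A_T` is a RIGIDIFIED FIBREWISE-`Pic⁰` line bundle when `ν̄² = Λ(L)`
# ([MumfordFogartyKirwan1994] Ch. 6 §2, last step of the proof of Prop. 6.11: «`L` and `L^Δ(kμ)` define 2 sections of `Pic(X/S)`»)

Layer `Literature/AlgebraicGeometry/AbelianSchemes`, namespace `Literature.AlgebraicGeometry.AbelianSchemes.AbelianSchemeOver`.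
THEOREMS ONLY (no definition, no named fact, no instance, no notation, no `sorry`).  Cell `hodgecm-mathlib` (D-0151), F-DAG row
F-2 (e) «MFK Prop. 6.11», brick B3b (family half) of the census `B-provers/B-p17/g12/CENSUS-F2e-MFK611.B-p17g12.md` (B-p17 (g12));
consumer: the closed locus «`L_T ≅ L^Δ_T(kμ)`» through ★ `DualPair.exists_isClosedImmersion_iff_nonempty_comap_iso_unit`
(`RigidifiedTrivialityLocusClosed`), whose input is exactly an `A.RigidifiedLineBundle b` that is `FibrewisePicZero`.
HC_CM is proved only modulo the 7 printed citations until rung 0 closes; nothing here is about HC.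

SETTING.  `A/S` an abelian scheme over a locally Noetherian base (ed. 2: connectedness dropped — ed. 1 needed it only through ★
`AbelianSchemeLDeltaHalfPicZero`, whose ed. 2 is any-base via ★ `PoincareSheafBiadditiveAnyBase`), `D = (Â, 𝒫)` a dual pair with the unit hypothesis `hD`,
`L` a rank-one module on `A` rigidified along `ε_A` (`hε`, class form), `lam : A → Â` classifying the Mumford family of `L`
(hypothesis (ii) of ★ `exists_isMonHom_classify_mumfordBundle`), `2` invertible in the residue fields of `S`.  Over `b : T ⟶ S`
(ANY `T`) let `A_T = A.baseChange b` with projection `pr : A_T → A`, and let `g : A_T → Â` be an `A_T`-valued point of `Â` over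
`S` whose SQUARE in the group `Hom_S(A_T, Â)` is `pr ≫ lam` («`ν̄² = Λ(L)`»; in Prop. 6.11, `g` is the point of `ν = kμ` for the
descended `μ`, `[2k] ≫ μ = Λ(L)_T`); `Γ = (pr, g) : A_T → A ×_S Â` (given by its two projections) and
**`N := pr^*L ⊗ (Γ^*𝒫)^∨`** = «`L_T ⊗ L^Δ_T(ν)⁻¹`» on `A_T`.

* §1 `hasRank_halfFamily` (rank one), **`rigid_halfFamily`** (`ε_T^*N ≅ 𝒪_T`: `ε_T ≫ pr = b ≫ ε_A` kills `[L]` by `hε`, and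
  `ε_T ≫ Γ = (ε_T ≫ g) ≫ (ε_A × 1)` kills `[𝒫]` by the normalisation of `𝒫`, ★ `pullback_unitSlice_detClass_P`);
* §2 **`fibrewisePicZero_halfFamily`** — at a geometric point `t` of `T` the fibre of `N` is, along ★ `fibreBaseChangeIso`
  `(A_T)_t ≅ A_{t ≫ b}`, the module `ι^*L ⊗ ((ι, G)^*𝒫)⁻¹` of ★ `isHomogeneous_tensor_dual_pullback_graph` (B3a) for the
  `A_{t≫b}`-valued point `G = (ι_t-restriction of g)`, whose square is `ι ≫ lam`; hence homogeneous;
  **`exists_rigidifiedLineBundle_halfFamily`** — `N` packaged as an `A.RigidifiedLineBundle b` which is `FibrewisePicZero`.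

## References
* [MumfordFogartyKirwan1994] D. Mumford, J. Fogarty, F. Kirwan, *Geometric Invariant Theory*, 3rd ed. (1994), Ch. 6 §2
  Prop. 6.11 (p. 122; proof pp. 122–123), §2 p. 121 (normalisation of `L^Δ`).
* [MumfordAV1970] D. Mumford, *Abelian Varieties* (1970), §8 (pp. 74–75), §13 (p. 123).
* [MilneAV2008] J. S. Milne, *Abelian Varieties* (v2.00, 2008), I §8 pp. 36–37.
* [GortzWedhorn2020] U. Görtz, T. Wedhorn, *Algebraic Geometry I*, 2nd ed. (2020), Section (4.7) (pp. 107–108).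
-/

-- `Scheme.Modules` / `SheafOfModules` are not reducible (as in Mathlib's `AlgebraicGeometry/Modules/Sheaf.lean`).
set_option backward.isDefEq.respectTransparency false

noncomputable section

open CategoryTheory CategoryTheory.Limits AlgebraicGeometry MonoidalCategory CartesianMonoidalCategory
open scoped MonObj

universe u

namespace Literature.AlgebraicGeometry.AbelianSchemes

open Literature.AlgebraicGeometry.Motives Literature.AlgebraicGeometry.Modules
  Literature.AlgebraicGeometry.AbelianVarieties

namespace AbelianSchemeOver

variable {S : Scheme.{u}} (A : AbelianSchemeOver S) (D : A.DualPair) {L : A.left.Modules} (hL : HasRank L 1)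
  (hε : CechPic.pullback A.unitSection (detClass (HasRank.isFiniteLocallyFree' hL)) = 1)
  (lam : A.X ⟶ D.hat.X)
  (hlam : ∀ ⦃T : Over S⦄ (u : T ⟶ A.X),
    Nonempty (D.pullbackP T.hom (u ≫ lam).left (Over.w _) ≅
      (Scheme.Modules.pullback (A.X ◁ u).left).obj (A.mumfordBundle L)))
  {T : Scheme.{u}} (b : T ⟶ S) (g : (A.baseChange b).left ⟶ D.hat.X.left)
  (hg : g ≫ D.hat.X.hom = (A.baseChange b).X.hom ≫ b)
  (Γ : (A.baseChange b).left ⟶ A.prodLeft D.hat)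
  (hΓ₁ : Γ ≫ pullback.fst A.X.hom D.hat.X.hom = pullback.fst A.X.hom b) (hΓ₂ : Γ ≫ pullback.snd A.X.hom D.hat.X.hom = g)

/-! ## §1 Rank and rigidification of `N = pr^*L ⊗ (Γ^*𝒫)^∨` -/

include hL in
/-- `N = pr^*L ⊗ (Γ^*𝒫)^∨` is a line bundle. [cite: MumfordFogartyKirwan1994, Ch. 6 §2 Prop. 6.11 (p. 122; proof pp. 122–123)] -/
theorem hasRank_halfFamily :
    HasRank (tensorObj ((Scheme.Modules.pullback (pullback.fst A.X.hom b)).obj L)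
      (Modules.dual ((Scheme.Modules.pullback Γ).obj D.P))) 1 :=
  hasRank_tensorObj_one (hasRank_pullback _ hL) (hasRank_dual (hasRank_pullback _ D.hasRank_one))

include hε hg hΓ₁ hΓ₂ in
/-- **`N` is rigidified along `ε_T`**: in `Ȟ¹(T, 𝒪^×)`, `ε_T^*[N] = (ε_T ≫ pr)^*[L] · ((ε_T ≫ Γ)^*[𝒫])⁻¹` with `ε_T ≫ pr = b ≫ ε_A`
(★ `unitSection_baseChange_comp_fst`; `ε_A^*[L] = 1` is `hε`) and `ε_T ≫ Γ = (ε_T ≫ g) ≫ (ε_A × 1_Â)` (`(ε_A × 1)^*[𝒫] = 1`, ★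
`pullback_unitSlice_detClass_P`) — both normalisations of MFK p. 121 («`L^Δ(λ)` is always normalized along the identity
section»). [cite: MumfordFogartyKirwan1994, Ch. 6 §2 (p. 121) and Prop. 6.11 (p. 122; proof pp. 122–123)]
[cite: MilneAV2008, I §8 pp. 36–37] -/
theorem rigid_halfFamily :
    Nonempty ((Scheme.Modules.pullback (A.baseChange b).unitSection).obj
      (tensorObj ((Scheme.Modules.pullback (pullback.fst A.X.hom b)).obj L)
        (Modules.dual ((Scheme.Modules.pullback Γ).obj D.P))) ≅ SheafOfModules.unit _) := by
  have hP : IsFiniteLocallyFree D.P := HasRank.isFiniteLocallyFree' D.hasRank_one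
  have hLb : HasRank ((Scheme.Modules.pullback (pullback.fst A.X.hom b)).obj L) 1 := hasRank_pullback _ hL
  have hΓP : HasRank ((Scheme.Modules.pullback Γ).obj D.P) 1 := hasRank_pullback _ D.hasRank_one
  have hΓPd : HasRank (Modules.dual ((Scheme.Modules.pullback Γ).obj D.P)) 1 := hasRank_dual hΓP
  have hN := hasRank_tensorObj_one hLb hΓPd
  refine (nonempty_iso_iff_detClass_eq (hasRank_pullback _ hN) hasRank_unitModule
    ((HasRank.isFiniteLocallyFree' hN).pullback _) (HasRank.isFiniteLocallyFree' hasRank_unitModule)).2 ?_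
  rw [detClass_unitModule_eq_one, detClass_pullback _ (HasRank.isFiniteLocallyFree' hN),
    detClass_tensorObj_of_hasRank_one hLb hΓPd (HasRank.isFiniteLocallyFree' hLb) (HasRank.isFiniteLocallyFree' hΓPd)
      (HasRank.isFiniteLocallyFree' hN),
    detClass_dual' (HasRank.isFiniteLocallyFree' hΓP) (HasRank.isFiniteLocallyFree' hΓPd),
    (detClass_eq_of_iso (Iso.refl _) (HasRank.isFiniteLocallyFree' hΓP) (hP.pullback Γ)).trans (detClass_pullback Γ hP),
    (detClass_eq_of_iso (Iso.refl _) (HasRank.isFiniteLocallyFree' hLb)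
      ((HasRank.isFiniteLocallyFree' hL).pullback (pullback.fst A.X.hom b))).trans
      (detClass_pullback _ (HasRank.isFiniteLocallyFree' hL)),
    map_mul, map_inv]
  -- `ε_T ≫ pr = b ≫ ε_A` kills `[L]`
  have e₁ : CechPic.pullback (A.baseChange b).unitSection
      (CechPic.pullback (pullback.fst A.X.hom b) (detClass (HasRank.isFiniteLocallyFree' hL))) = 1 :=
    (CechPic.pullback_comp _ _ _).symm.trans
      (by rw [A.unitSection_baseChange_comp_fst b, CechPic.pullback_comp, hε, map_one])
  -- `ε_T ≫ Γ = (ε_T ≫ g) ≫ (ε_A × 1)` kills `[𝒫]`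
  have hεg : ((A.baseChange b).unitSection ≫ g) ≫ D.hat.X.hom = b := by
    rw [Category.assoc, hg, ← Category.assoc, (A.baseChange b).unitSection_comp_hom, Category.id_comp]
  have hεΓ : (A.baseChange b).unitSection ≫ Γ = ((A.baseChange b).unitSection ≫ g) ≫ A.unitSlice D.hat := by
    apply pullback.hom_ext
    · rw [Category.assoc, hΓ₁, A.unitSection_baseChange_comp_fst b, Category.assoc, A.unitSlice_fst,
        ← Category.assoc, hεg]
    · rw [Category.assoc, hΓ₂, Category.assoc, A.unitSlice_snd, Category.comp_id]
  have e₂ : CechPic.pullback (A.baseChange b).unitSection (CechPic.pullback Γ (detClass hP)) = 1 :=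
    (CechPic.pullback_comp _ _ _).symm.trans
      (by rw [hεΓ, CechPic.pullback_comp, A.pullback_unitSlice_detClass_P D hP, map_one])
  exact (congrArg₂ (fun x y => x * y⁻¹) e₁ e₂).trans (by rw [inv_one, mul_one])

/-! ## §2 `N` lies fibrewise in `Pic⁰` -/

section Fibrewise

variable [IsLocallyNoetherian S]
  (hD : Nonempty ((Scheme.Modules.pullback (DualPair.unitHatSlice D)).obj D.P ≅ SheafOfModules.unit _))
  (h2 : ∀ s : S, ((2 : ℕ) : S.residueField s) ≠ 0)
  (hgg : (Over.homMk g hg : Over.mk ((A.baseChange b).X.hom ≫ b) ⟶ D.hat.X) *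
      (Over.homMk g hg : Over.mk ((A.baseChange b).X.hom ≫ b) ⟶ D.hat.X) =
    (Over.homMk (pullback.fst A.X.hom b) pullback.condition : Over.mk ((A.baseChange b).X.hom ≫ b) ⟶ A.X) ≫ lam)

include hL hlam hD h2 hgg hΓ₁ hΓ₂ in
/-- **`N = pr^*L ⊗ (Γ^*𝒫)^∨` lies FIBREWISE IN `Pic⁰`** ([MumfordFogartyKirwan1994] p. 123: `L ⊗ L^Δ(kμ)⁻¹` is a section of
`Pic(X/S)`, here of its `Pic⁰`-part `Â`): at a geometric point `t : Spec Ω → T` the fibre `(A_T)_t` is `A_{t ≫ b}` (★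
`fibreBaseChangeIso`), along which the fibre module of `N` becomes `ι^*L ⊗ ((ι, G)^*𝒫)⁻¹` for the restriction `G` of `g` to
the fibre — an `A_{t≫b}`-valued point of `Â` with `G·G = ι ≫ lam` — which is homogeneous by B3a ★
`isHomogeneous_tensor_dual_pullback_graph` (square trick + «`2`-divisible kills `2`-torsion»).
[cite: MumfordFogartyKirwan1994, Ch. 6 §2 Prop. 6.11 (p. 122; proof pp. 122–123) and Prop. 6.10 (p. 121)]
[cite: MumfordAV1970, §8 (pp. 74–75)] [cite: GortzWedhorn2020, Section (4.7) (pp. 107–108)] -/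
theorem fibrewisePicZero_halfFamily :
    (⟨tensorObj ((Scheme.Modules.pullback (pullback.fst A.X.hom b)).obj L)
        (Modules.dual ((Scheme.Modules.pullback Γ).obj D.P)),
      A.hasRank_halfFamily D hL b Γ, A.rigid_halfFamily D hL hε b g hg Γ hΓ₁ hΓ₂⟩ :
        A.RigidifiedLineBundle b).FibrewisePicZero := by
  intro Ω _ _ t
  have hP : IsFiniteLocallyFree D.P := HasRank.isFiniteLocallyFree' D.hasRank_one
  -- the geometric point `s = t ≫ b` of `S`, the two fibres and the comparison `φ : (A_T)_t ≅ A_s`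
  let s : Spec (.of Ω) ⟶ S := t ≫ b
  let φ := A.fibreBaseChangeIso b t
  let ιt : ((A.baseChange b).fibre t).toAbelianVariety.X.left ⟶ (A.baseChange b).left :=
    pullback.fst (A.baseChange b).X.hom t
  let ιs : (A.fibre s).toAbelianVariety.X.left ⟶ A.X.left := pullback.fst A.X.hom s
  have hφ : AbelianVariety.Hom.toSchemeHom φ.hom ≫ ιs = ιt ≫ pullback.fst A.X.hom b :=
    A.fibreBaseChangeIso_hom_toSchemeHom_fst b t
  have hφφ : AbelianVariety.Hom.toSchemeHom φ.inv ≫ AbelianVariety.Hom.toSchemeHom φ.hom = 𝟙 _ :=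
    congrArg AbelianVariety.Hom.toSchemeHom φ.inv_hom_id
  have hφφ' : AbelianVariety.Hom.toSchemeHom φ.hom ≫ AbelianVariety.Hom.toSchemeHom φ.inv = 𝟙 _ :=
    congrArg AbelianVariety.Hom.toSchemeHom φ.hom_inv_id
  -- `g` restricted to the fibre `A_s`, as an `A_s`-valued point of `Â` over `S`
  let ψ : (A.fibre s).toAbelianVariety.X.left ⟶ (A.baseChange b).left := AbelianVariety.Hom.toSchemeHom φ.inv ≫ ιt
  have hψ : ψ ≫ pullback.fst A.X.hom b = ιs := by
    change (AbelianVariety.Hom.toSchemeHom φ.inv ≫ ιt) ≫ pullback.fst A.X.hom b = ιs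
    rw [Category.assoc, ← hφ, ← Category.assoc, hφφ, Category.id_comp]
  have hcond : pullback.fst A.X.hom b ≫ A.X.hom = (A.baseChange b).X.hom ≫ b := pullback.condition
  have hψS : ψ ≫ ((A.baseChange b).X.hom ≫ b) = ιs ≫ A.X.hom := by
    rw [← hcond, ← Category.assoc, hψ]
  let Ψ : Over.mk (ιs ≫ A.X.hom) ⟶ Over.mk ((A.baseChange b).X.hom ≫ b) := Over.homMk ψ hψS
  let G : Over.mk (ιs ≫ A.X.hom) ⟶ D.hat.X :=
    Ψ ≫ (Over.homMk g hg : Over.mk ((A.baseChange b).X.hom ≫ b) ⟶ D.hat.X)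
  have hGl : G.left = ψ ≫ g := rfl
  have hΨa : Ψ ≫ (Over.homMk (pullback.fst A.X.hom b) pullback.condition : Over.mk ((A.baseChange b).X.hom ≫ b) ⟶ A.X) =
      (Over.homMk (pullback.fst A.X.hom s) rfl : Over.mk (pullback.fst A.X.hom s ≫ A.X.hom) ⟶ A.X) :=
    Over.OverMorphism.ext hψ
  have hGG : G * G =
      (Over.homMk (pullback.fst A.X.hom s) rfl : Over.mk (pullback.fst A.X.hom s ≫ A.X.hom) ⟶ A.X) ≫ lam := by
    change (Ψ ≫ _) * (Ψ ≫ _) = _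
    rw [← MonObj.comp_mul, hgg, ← Category.assoc, hΨa]
  -- the graph on the fibre and the core lemma
  let gr : (A.fibre s).toAbelianVariety.X.left ⟶ A.prodLeft D.hat :=
    pullback.lift ιs (ψ ≫ g) (by rw [Category.assoc, hg, hψS])
  have hgr₁ : gr ≫ pullback.fst A.X.hom D.hat.X.hom = pullback.fst A.X.hom s := pullback.lift_fst _ _ _
  have hgr₂ : gr ≫ pullback.snd A.X.hom D.hat.X.hom = G.left := pullback.lift_snd _ _ _
  have h2Ω : (2 : Ω) ≠ 0 := by
    -- `Ω` receives the residue field at the centre of `s`, where `2 ≠ 0`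
    have h := h2 (s (IsLocalRing.closedPoint Ω))
    let ρ : S.residueField (s (IsLocalRing.closedPoint Ω)) →+* Ω :=
      (S.descResidueField (Scheme.stalkClosedPointTo s)).hom
    have h' : ((2 : ℕ) : Ω) ≠ 0 := by rw [← map_natCast ρ 2]; exact (map_ne_zero ρ).mpr h
    exact_mod_cast h'
  have hM := A.isHomogeneous_tensor_dual_pullback_graph D hL lam hlam s hD h2Ω G hGG gr hgr₁ hgr₂
  -- transport along `φ`: the fibre module of `N` is `φ^*` of the core module (compare classes)
  rw [← isHomogeneous_pullback_iff_of_iso φ] at hM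
  have hNr := A.hasRank_halfFamily D hL b Γ
  have hMr : HasRank (tensorObj
      ((Scheme.Modules.pullback (X := (A.fibre s).toAbelianVariety.X.left) (pullback.fst A.X.hom s)).obj L)
      (Modules.dual ((Scheme.Modules.pullback gr).obj D.P))) 1 :=
    hasRank_tensorObj_one (hasRank_pullback _ hL) (hasRank_dual (hasRank_pullback _ D.hasRank_one))
  refine (isHomogeneous_iff_of_iso _ (Classical.choice ((nonempty_iso_iff_detClass_eq (hasRank_pullback ιt hNr)
    (hasRank_pullback (AbelianVariety.Hom.toSchemeHom φ.hom) hMr) ((HasRank.isFiniteLocallyFree' hNr).pullback ιt)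
    ((HasRank.isFiniteLocallyFree' hMr).pullback (AbelianVariety.Hom.toSchemeHom φ.hom))).2 ?_))).2 hM
  -- classes: `(φ ≫ ι_s)^*[L]·((φ ≫ gr)^*[𝒫])⁻¹ = (ι_t ≫ pr)^*[L]·((ι_t ≫ Γ)^*[𝒫])⁻¹`
  have hLs : HasRank ((Scheme.Modules.pullback (X := (A.fibre s).toAbelianVariety.X.left) ιs).obj L) 1 :=
    hasRank_pullback _ hL
  have hgrP : HasRank ((Scheme.Modules.pullback gr).obj D.P) 1 := hasRank_pullback _ D.hasRank_one
  have hLb : HasRank ((Scheme.Modules.pullback (pullback.fst A.X.hom b)).obj L) 1 := hasRank_pullback _ hL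
  have hΓP : HasRank ((Scheme.Modules.pullback Γ).obj D.P) 1 := hasRank_pullback _ D.hasRank_one
  have hφgr : AbelianVariety.Hom.toSchemeHom φ.hom ≫ gr = ιt ≫ Γ := by
    apply pullback.hom_ext
    · rw [Category.assoc, hgr₁, hφ, Category.assoc, hΓ₁]
    · rw [Category.assoc, hgr₂, hGl, Category.assoc ιt Γ, hΓ₂]
      change AbelianVariety.Hom.toSchemeHom φ.hom ≫ (AbelianVariety.Hom.toSchemeHom φ.inv ≫ ιt) ≫ g = ιt ≫ g
      rw [← Category.assoc, ← Category.assoc, hφφ', Category.id_comp]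
  -- the two factors of the class, compared along `φ`
  have eL : CechPic.pullback ιt (CechPic.pullback (pullback.fst A.X.hom b) (detClass (HasRank.isFiniteLocallyFree' hL))) =
      CechPic.pullback (AbelianVariety.Hom.toSchemeHom φ.hom)
        (CechPic.pullback ιs (detClass (HasRank.isFiniteLocallyFree' hL))) :=
    ((CechPic.pullback_comp ιt (pullback.fst A.X.hom b) _).symm.trans (by rw [← hφ])).trans
      (CechPic.pullback_comp _ ιs _)
  have eP : CechPic.pullback ιt (CechPic.pullback Γ (detClass hP)) =
      CechPic.pullback (AbelianVariety.Hom.toSchemeHom φ.hom) (CechPic.pullback gr (detClass hP)) :=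
    ((CechPic.pullback_comp ιt Γ _).symm.trans (by rw [← hφgr])).trans (CechPic.pullback_comp _ gr _)
  rw [detClass_pullback _ (HasRank.isFiniteLocallyFree' hNr), detClass_pullback _ (HasRank.isFiniteLocallyFree' hMr),
    detClass_tensorObj_of_hasRank_one hLs (hasRank_dual hgrP) (HasRank.isFiniteLocallyFree' hLs)
      (HasRank.isFiniteLocallyFree' (hasRank_dual hgrP)) (HasRank.isFiniteLocallyFree' hMr),
    detClass_tensorObj_of_hasRank_one hLb (hasRank_dual hΓP) (HasRank.isFiniteLocallyFree' hLb)
      (HasRank.isFiniteLocallyFree' (hasRank_dual hΓP)) (HasRank.isFiniteLocallyFree' hNr),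
    detClass_dual' (HasRank.isFiniteLocallyFree' hgrP) (HasRank.isFiniteLocallyFree' (hasRank_dual hgrP)),
    detClass_dual' (HasRank.isFiniteLocallyFree' hΓP) (HasRank.isFiniteLocallyFree' (hasRank_dual hΓP)),
    (detClass_eq_of_iso (Iso.refl _) (HasRank.isFiniteLocallyFree' hgrP) (hP.pullback gr)).trans (detClass_pullback gr hP),
    (detClass_eq_of_iso (Iso.refl _) (HasRank.isFiniteLocallyFree' hΓP) (hP.pullback Γ)).trans (detClass_pullback Γ hP),
    (detClass_eq_of_iso (Iso.refl _) (HasRank.isFiniteLocallyFree' hLs) ((HasRank.isFiniteLocallyFree' hL).pullback ιs)).trans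
      (detClass_pullback _ (HasRank.isFiniteLocallyFree' hL)),
    (detClass_eq_of_iso (Iso.refl _) (HasRank.isFiniteLocallyFree' hLb)
      ((HasRank.isFiniteLocallyFree' hL).pullback (pullback.fst A.X.hom b))).trans
      (detClass_pullback _ (HasRank.isFiniteLocallyFree' hL)),
    map_mul, map_mul, map_inv, map_inv]
  exact congrArg₂ (fun x y => x * y⁻¹) eL eP

include hL hlam hD h2 hgg hε hg hΓ₁ hΓ₂ in
/-- **`N` packaged**: there is a rigidified line bundle `ℒ` on `A_T` (★ `RigidifiedLineBundle`) with underlying module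
`N = pr^*L ⊗ (Γ^*𝒫)^∨` which lies fibrewise in `Pic⁰` — the test object on which ★ `RigidifiedTrivialityLocusClosed` yields the
closed locus «`L_T ≅ L^Δ_T(ν)`». [cite: MumfordFogartyKirwan1994, Ch. 6 §2 Prop. 6.11 (p. 122; proof pp. 122–123)]
[cite: MilneAV2008, I §8 pp. 36–37] -/
theorem exists_rigidifiedLineBundle_halfFamily :
    ∃ ℒ : A.RigidifiedLineBundle b,
      ℒ.L = tensorObj ((Scheme.Modules.pullback (pullback.fst A.X.hom b)).obj L)
        (Modules.dual ((Scheme.Modules.pullback Γ).obj D.P)) ∧ ℒ.FibrewisePicZero :=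
  ⟨_, rfl, A.fibrewisePicZero_halfFamily D hL hε lam hlam b g hg Γ hΓ₁ hΓ₂ hD h2 hgg⟩

end Fibrewise

end AbelianSchemeOver

end Literature.AlgebraicGeometry.AbelianSchemes

end
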